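import Summits.QuantumFields.YangMills.Theorems.BalabanUVNodesN15PerCubeGreenCutRows
import Summits.QuantumFields.YangMills.Theorems.BalabanUVNodesN15PerCubeGreenFineCutRows
import Summits.QuantumFields.YangMills.Theorems.BalabanUVNodesN15TwoSpacingGluingCurvedCoverDefect
import Summits.QuantumFields.YangMills.Theorems.BalabanUVNodesN15CovariantAveragingTwoGrid
import HarnessLib

/-!
# N15 = NE2 — PROGRAMME (PC-E), (m4)-A part 1: 53's TWO-GRID CUT ROWS `hDcut`∕`hDcutF`∕`hDcutB` ON SITES — the flat two-grid η-defects of the cut compressed torus Green's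
# functions `M_{χ_k}∘[∇^{(±)}_μ∘]G′(1)∘M_{ψ_k}` of the (PC) site knit under King's pairing `π = kingPr`, from dag-n15-a's flat two-grid rows Ξ-4 r9∕r10∕r12 by the EXACT
# commutation of the cube cut-offs with the pairing (cubes are unions of coarse blocks) (dag-n15-a g37, by dag-n15-c g31's ASK (m4)-A)

Cell `pub-ymgap`, seat `pub-ymgap-dag-n15-a` (generation g37; KNIT-BY-NAME, count-neutral; HUMAN RULING D-0062; chair R424 venue).  `bears_on: R4∕N15 · K3⁸
SpineGivenEndpointR13SepCoPHV (stmt-QuantumFields-27366)`; filed `--supports stmt-QuantumFields-27366 --as helper` — COUNT-NEUTRAL.  THEOREMS only ([folklore] bookkeeping),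
0 `def`, 0 `sorry`.  Imports BY NAME n15-c∕261b `…PerCubeGreenCutRows` + 261b′ `…PerCubeGreenFineCutRows` (`fgrad∕bgrad_comp_mulVecLin_eq_pull(′)`; through them n15-c∕261
`hasMaj_comp_mulOp_cut`∕`hasMaj_mulOp_cut_comp`∕`hasMaj_pullCarrier_comp`, the site objects 260∕260′), n15-c∕122 `…TwoSpacingGluingCurvedCoverDefect` (`idef_cut_comp`,
`hasMaj_tgt_congr`, dag-n15-a `blockOf_mem_cubeBlocks_of_inner_ne_zero`), n15-c∕183 `…CovariantAveragingTwoGrid` (`blockOf_kingPr`), dag-n15-a `chiCube_kingPrV`, pub-balaban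
`T4EtaRateDefect.idef`.  Nothing in the tree is modified, no landed name re-declared.

WHY (dag-n15-c g31 `PCE-DESIGN-g31.md` §5 (2)–(3), ASK I.20924).  The amended (PC-E) architecture of record runs dag-n15-w3's two-grid random walk 53 on SITES with the covariant
transport per piece; its displayed two-grid rows (b) are the FLAT two-grid defects `𝔇_{pull}` of the cut cube pieces `M_{χ_k}N_k`, `M_{χ_k}∇_μN_k`, `M_{χ_k}∇⁻_μN_k` with
`N_k = G′(1)∘M_{ψ_k}` (n15-c∕260 `scCube`), between the coarse unit-block norm and the fine one read through `π`.  THIS FILE produces them from dag-n15-a's flat two-grid kernel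
rows of King's torus Green's function (Ξ-4 `flatRowsAll_king` r9: `𝔇(G′, G)`, r10: `𝔇(∂G′, ∂G)`, r12: `𝔇(S̄ₕ∂G′, S̄ₕ∂G)`, rate `C(L^k)^{−γ}`; taken here as displayed hypotheses at any
masses `a, a′` so the consumer feeds the conjuncts it holds) by EXACT algebra: `χ′_k = χ_k ∘ π`, `ψ′_k = ψ_k ∘ π` (the cuts are indicators of unions of UNIT blocks and `π` preserves
unit blocks, `blockOf_kingPr`), hence `𝔇(M_{χ′}A′M_{ψ′}, M_χ A M_ψ) = M_{χ′}∘𝔇(A′, A)∘M_ψ`, and `∇_μ∘mulVecLin G = pull_μ∘mulVecLin(∂G)` on both grids with `P̂_sites∘pull_μ =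
pull_μ∘P̂_bonds`.

RESULTS ([folklore] bookkeeping; shapes = 53's `hDcut`∕`hDcutF`∕`hDcutB` with `X = ScX`, `X′ = ScX′`, `π = kingPr L kk r (cvM…)`, `blk = scBlk`, `Sk k = cvSk k`).
* §1 `scChi'_eq_scChi_kingPr`, `scPsi'_eq_scPsi_kingPr` (exact), the intertwinings `pull_comp_mulOp_scChi`, `mulOp_scPsi'_comp_pull`, `idef_comp_cut` (right-cut twin of
  n15-c's `idef_cut_comp`), `idef_pullSlice` (`𝔇_{P̂,P̂}(pull_μ D′, pull_μ D) = pull_μ ∘ 𝔇_{P̂,P̂_V}(D′, D)`), `liftBlk_scBlk_comp_liftMap_kingPr`.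
* §2 ★★ `hasMaj_idef_cut_scCube` (53's `hDcut` on sites from Ξ-4 r9-shaped `hDG`), ★★ `hasMaj_idef_cutF_scCube` (`hDcutF` from r10-shaped `hDGF`), ★★ `hasMaj_idef_cutB_scCube`
  (`hDcutB` from r12-shaped `hDGB`) — majorants `1_□(y)1_□(y′)·K`.

HONEST FRAMING ∕ LIMITS.  Bookkeeping over displayed flat rows; no new analytic estimate; MODEL carriers (the doubled-cube torus cover, compressed TORUS propagators as local
operators); nothing of [B9] asserted; NE2⁺ NOT PRINTED, NOT proved; N15 of record untouched (DISCHARGED AS CONSUMED, p687738); K3⁸ OPEN; counts of record UNMOVED (typed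
28∕28 · discharged 8∕27); one finite 𝕋⁴ at fixed ε per index — NOT infinite volume, NOT OS on ℝ⁴, NOT a mass gap, NOT Clay.  Restate-immune (no Theses import).
-/

noncomputable section

open scoped BigOperators Matrix Matrix.Norms.Frobenius

namespace Summit.QuantumFields.YangMills.BalabanUVNodes.N15.Gluing

open Real
open Literature.MathematicalPhysics.QuantumFieldTheory.Balaban1983to89
open Literature.MathematicalPhysics.QuantumFieldTheory.Balaban1983to89.B5Prop11Plancherel (Tor fine unitVec)
open Literature.MathematicalPhysics.QuantumFieldTheory.Balaban1983to89.B11SectG (BlockNorm HasMaj)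
open Literature.MathematicalPhysics.QuantumFieldTheory.Balaban1983to89.B6Prop26Gluing (mulOp mulOp_apply ind ind_nonneg)
open Literature.MathematicalPhysics.QuantumFieldTheory.Balaban1983to89.B6UnitTorusCarrier (unitTorusGeo)
open Literature.MathematicalPhysics.QuantumFieldTheory.Balaban1983to89.T4EtaRateDefect (idef idef_comp)
open Literature.MathematicalPhysics.QuantumFieldTheory.Balaban1983to89.T4EtaRateCoeffDefect (pull pull_apply)
open Literature.MathematicalPhysics.QuantumFieldTheory.King1986.Torus (blockOf tdistT tdistT_nonneg)
open Summit.QuantumFields.YangMills.BalabanUVNodes.N15.BackgroundLayer (fgrad bgrad fgrad_apply bgrad_apply)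
open Summit.QuantumFields.YangMills.BalabanUVNodes.N15.VectorPiece (kingPr kingPrV kingPrV_eq)
open Summit.QuantumFields.YangMills.BalabanUVNodes.N15.MatrixSpecies (liftBlk liftMap liftEquiv liftEquiv_apply liftEquiv_symm_apply)
open Summit.QuantumFields.YangMills.BalabanUVNodes.N15.TwoGrid (chiCube cubeBlocks chiCube_of_not_mem abs_chiCube_le_one chiCube_kingPrV)
open Summit.QuantumFields.YangMills.BalabanUVNodes.N15.CovLandau (cgrad cGreen bBack)
open Summit.QuantumFields.YangMills.BalabanUVNodes.N15.CovAvg (blockOf_kingPr)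

variable {d : ℕ}

/-! ## §1 The cut-offs and the pairing commute exactly -/

section Pairing

variable {L : ℕ} [NeZero L] {mv kk r : ℕ} {hL : Odd L ∧ 1 < L} (ι : Type)

omit ι in
/-- THE FINE INPUT CUT IS THE COARSE ONE READ THROUGH THE PAIRING: `χ′_k(x′) = χ_k(πx′)` (both are indicators of the same union of UNIT blocks). [cite: King1986, p.664 (pairing convention)] -/
theorem scChi'_eq_scChi_kingPr (k : Fin (d + 1) → ZMod (2 * L)) (x' : ScX' d L mv kk r hL) :
    scChi' d L mv kk r hL k x' = scChi d L mv kk hL k (kingPr L kk r (cvM d L mv kk hL) x') :=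
  (chiCube_kingPrV (M := cvM d L mv kk hL) (L := L) (k := kk) (r := r) (c := coverCorner (cvM d L mv kk hL) (L ^ mv) L (2 * L ^ mv) k) (S := 6 * L ^ mv + 1) (x', 0)).symm

omit ι in
/-- THE FINE PLATEAU IS THE COARSE ONE READ THROUGH THE PAIRING: `ψ′_k(x′) = ψ_k(πx′)`. [cite: King1986, p.664 (pairing convention)] -/
theorem scPsi'_eq_scPsi_kingPr (k : Fin (d + 1) → ZMod (2 * L)) (x' : ScX' d L mv kk r hL) :
    scPsi' d L mv kk r hL k x' = scPsi d L mv kk hL k (kingPr L kk r (cvM d L mv kk hL) x') :=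
  (chiCube_kingPrV (M := cvM d L mv kk hL) (L := L) (k := kk) (r := r) (c := coverCorner (cvM d L mv kk hL) (L ^ mv) L (coverMargin L mv) k) (S := L * L ^ mv) (x', 0)).symm

/-- `P̂ ∘ M_{χ_k} = M_{χ′_k} ∘ P̂` on the coloured site carriers. [folklore] -/
theorem pull_comp_mulOp_scChi (k : Fin (d + 1) → ZMod (2 * L)) :
    pull (liftMap (kingPr L kk r (cvM d L mv kk hL)) ι) ∘ₗ mulOp (fun p : ScX d L mv kk hL × ι => scChi d L mv kk hL k p.1) =
      mulOp (fun p : ScX' d L mv kk r hL × ι => scChi' d L mv kk r hL k p.1) ∘ₗ pull (liftMap (kingPr L kk r (cvM d L mv kk hL)) ι) := by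
  refine LinearMap.ext fun f => funext fun p => ?_
  simp only [LinearMap.comp_apply, pull_apply, mulOp_apply, liftMap, scChi'_eq_scChi_kingPr]

/-- `M_{ψ′_k} ∘ P̂ = P̂ ∘ M_{ψ_k}` on the coloured site carriers. [folklore] -/
theorem mulOp_scPsi'_comp_pull (k : Fin (d + 1) → ZMod (2 * L)) :
    mulOp (fun p : ScX' d L mv kk r hL × ι => scPsi' d L mv kk r hL k p.1) ∘ₗ pull (liftMap (kingPr L kk r (cvM d L mv kk hL)) ι) =
      pull (liftMap (kingPr L kk r (cvM d L mv kk hL)) ι) ∘ₗ mulOp (fun p : ScX d L mv kk hL × ι => scPsi d L mv kk hL k p.1) := by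
  refine LinearMap.ext fun f => funext fun p => ?_
  simp only [LinearMap.comp_apply, pull_apply, mulOp_apply, liftMap, scPsi'_eq_scPsi_kingPr]

omit [NeZero L] in
/-- ★ RIGHT-CUT TWIN of n15-c's `idef_cut_comp`: `𝔇_{τ₁,τ₂}(A′∘M_{ψ′}, A∘M_ψ) = 𝔇_{τ₁,τ₂}(A′, A)∘M_ψ` whenever `M_{ψ′}∘τ₁ = τ₁∘M_ψ`. [folklore] -/
theorem idef_comp_cut {X X' F F' : Type} [AddCommGroup F] [Module ℝ F] [AddCommGroup F'] [Module ℝ F'] {τ₁ : (X → ℝ) →ₗ[ℝ] (X' → ℝ)} (τ₂ : F →ₗ[ℝ] F')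
    {ψ : X → ℝ} {ψ' : X' → ℝ} (hψ : mulOp ψ' ∘ₗ τ₁ = τ₁ ∘ₗ mulOp ψ) (A' : (X' → ℝ) →ₗ[ℝ] F') (A : (X → ℝ) →ₗ[ℝ] F) :
    idef τ₁ τ₂ (A' ∘ₗ mulOp ψ') (A ∘ₗ mulOp ψ) = idef τ₁ τ₂ A' A ∘ₗ mulOp ψ := by
  simp only [idef, LinearMap.sub_comp, LinearMap.comp_assoc, hψ]

omit [NeZero L] in
/-- ★ `𝔇_{τ₁,τ₂}(pull c′ ∘ D′, pull c ∘ D) = pull c′ ∘ 𝔇_{τ₁,τ₂′}(D′, D)` whenever `τ₂ ∘ pull c = pull c′ ∘ τ₂′` (a carrier pull-back read through two pairings). [folklore] -/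
theorem idef_pullSlice {X X' Y Y' F F' : Type} [AddCommGroup F] [Module ℝ F] [AddCommGroup F'] [Module ℝ F'] (τ₁ : F →ₗ[ℝ] F') {τ₂ : (X → ℝ) →ₗ[ℝ] (X' → ℝ)}
    {τ₂' : (Y → ℝ) →ₗ[ℝ] (Y' → ℝ)} {c : X → Y} {c' : X' → Y'} (h : τ₂ ∘ₗ pull c = pull c' ∘ₗ τ₂') (D' : F' →ₗ[ℝ] (Y' → ℝ)) (D : F →ₗ[ℝ] (Y → ℝ)) :
    idef τ₁ τ₂ (pull c' ∘ₗ D') (pull c ∘ₗ D) = pull c' ∘ₗ idef τ₁ τ₂' D' D := by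
  simp only [idef, LinearMap.comp_sub, LinearMap.comp_assoc]
  rw [← LinearMap.comp_assoc D (pull c) τ₂, h, LinearMap.comp_assoc]

omit [NeZero L] in
/-- the site pull-back and the `μ`-slice embeddings: `P̂_sites ∘ pull_μ = pull_μ ∘ P̂_bonds`. [folklore] -/
theorem pull_kingPr_comp_pullSlice (μ : Fin (d + 1)) :
    pull (liftMap (kingPr L kk r (cvM d L mv kk hL)) ι) ∘ₗ pull (fun p : ScX d L mv kk hL × ι => ((p.1, μ), p.2)) =
      pull (fun p : ScX' d L mv kk r hL × ι => ((p.1, μ), p.2)) ∘ₗ pull (liftMap (kingPrV L kk r (cvM d L mv kk hL)) ι) :=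
  LinearMap.ext fun _ => rfl

/-- the coarse unit-block map read through King's pairing IS the fine unit-block map, on the coloured site carrier. [cite: King1986, p.664 (pairing convention)] -/
theorem liftBlk_scBlk_comp_liftMap_kingPr :
    liftBlk (scBlk d L mv kk hL) ι ∘ liftMap (kingPr L kk r (cvM d L mv kk hL)) ι = liftBlk (blockOf (L ^ r * L ^ kk) (cvM d L mv kk hL)) ι :=
  funext fun p => blockOf_kingPr (cvM d L mv kk hL) L kk r p.1

/-- … and for the coloured BOND carriers of the gradient pieces. [cite: King1986, p.664 (pairing convention)] -/
theorem liftBlk_blockOf_comp_liftMap_kingPrV :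
    liftBlk (fun b : ScX d L mv kk hL × Fin (d + 1) => blockOf (L ^ kk) (cvM d L mv kk hL) b.1) ι ∘ liftMap (kingPrV L kk r (cvM d L mv kk hL)) ι =
      liftBlk (fun b : ScX' d L mv kk r hL × Fin (d + 1) => blockOf (L ^ r * L ^ kk) (cvM d L mv kk hL) b.1) ι :=
  funext fun p => by simp only [Function.comp_apply, liftBlk, kingPrV_eq]; exact blockOf_kingPr (cvM d L mv kk hL) L kk r p.1.1

end Pairing

/-! ## §2 53's two-grid cut rows on sites -/

section CutRows

variable {L : ℕ} [NeZero L] {mv kk r : ℕ} {hL : Odd L ∧ 1 < L} (ι : Type) [Fintype ι] [DecidableEq ι]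

variable (hM : ∀ ν, cvM d L mv kk hL ν = 2 * L * L ^ mv) (hm₁ : 2 * L ^ mv ≤ coverMargin L mv) (hfitI : coverMargin L mv - 2 * L ^ mv + (6 * L ^ mv + 1) ≤ L * L ^ mv)
  (hS0 : L * L ^ mv ≤ 2 * L * L ^ mv)
include hM hm₁ hfitI hS0

/-- ★★ **53's `hDcut` ON SITES**: `𝔇_{P̂,P̂}(M_{χ′_k}∘G′′(1)∘M_{ψ′_k}, M_{χ_k}∘G′(1)∘M_{ψ_k}) ≤ 1_□(y)1_□(y′)·K` from the flat two-grid row `𝔇_{P̂,P̂}(G′′(1), G′(1)) ≤ K` of the compressed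
torus Green's functions (Ξ-4 `flatRowsAll_king` r9 shape, any masses `a′, a`). [cite: Balaban1985BackgroundPropagators, Thm 3.14 pp.426–427 (two-grid difference: template), (3.87) p.409; King1986, p.664] -/
theorem hasMaj_idef_cut_scCube {a a' : ℝ} {K : Tor (cvM d L mv kk hL) → Tor (cvM d L mv kk hL) → ℝ} (hK : ∀ y y', 0 ≤ K y y')
    (hDG : HasMaj (ScNorm d L mv kk hL ι) (BlockNorm.ofBlocks (unitTorusGeo L kk (cvM d L mv kk hL)) (liftBlk (blockOf (L ^ r * L ^ kk) (cvM d L mv kk hL)) ι))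
      (idef (pull (liftMap (kingPr L kk r (cvM d L mv kk hL)) ι)) (pull (liftMap (kingPr L kk r (cvM d L mv kk hL)) ι))
        (Matrix.mulVecLin (cGreen (cvM d L mv kk hL) (L ^ r * L ^ kk) (fun (_ : Fin (d + 1)) (_ : ScX' d L mv kk r hL) => (1 : Matrix ι ι ℝ)) a'))
        (Matrix.mulVecLin (cGreen (cvM d L mv kk hL) (L ^ kk) (fun (_ : Fin (d + 1)) (_ : ScX d L mv kk hL) => (1 : Matrix ι ι ℝ)) a))) K)
    (k : Fin (d + 1) → ZMod (2 * L)) :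
    HasMaj (ScNorm d L mv kk hL ι) (BlockNorm.ofBlocks (unitTorusGeo L kk (cvM d L mv kk hL)) (liftBlk (scBlk d L mv kk hL) ι ∘ liftMap (kingPr L kk r (cvM d L mv kk hL)) ι))
      (idef (pull (liftMap (kingPr L kk r (cvM d L mv kk hL)) ι)) (pull (liftMap (kingPr L kk r (cvM d L mv kk hL)) ι))
        (mulOp (fun p : ScX' d L mv kk r hL × ι => scChi' d L mv kk r hL k p.1) ∘ₗ scCube' d L mv kk r hL a' ι k)
        (mulOp (fun p : ScX d L mv kk hL × ι => scChi d L mv kk hL k p.1) ∘ₗ scCube d L mv kk hL a ι k))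
      (fun y y' => ind (cvSk d L mv kk hL k) y * ind (cvSk d L mv kk hL k) y' * K y y') := by
  rw [scCube, scCube', idef_cut_comp _ _ (pull_comp_mulOp_scChi (d := d) (hL := hL) ι k), idef_comp_cut _ (mulOp_scPsi'_comp_pull (d := d) (hL := hL) ι k)]
  have h1 := hasMaj_comp_mulOp_cut (b₂ := BlockNorm.ofBlocks (unitTorusGeo L kk (cvM d L mv kk hL)) (liftBlk (blockOf (L ^ r * L ^ kk) (cvM d L mv kk hL)) ι))
    (liftBlk (scBlk d L mv kk hL) ι) hK (S := cvSk d L mv kk hL k) (χ := fun p : ScX d L mv kk hL × ι => scPsi d L mv kk hL k p.1) (fun p => abs_chiCube_le_one _ _)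
    (fun p hp => Finset.mem_coe.mpr (by by_contra h; exact hp (chiCube_of_not_mem h))) hDG
  have h2 := hasMaj_mulOp_cut_comp (b₁ := ScNorm d L mv kk hL ι) (liftBlk (scBlk d L mv kk hL) ι ∘ liftMap (kingPr L kk r (cvM d L mv kk hL)) ι)
    (fun y y' => mul_nonneg (ind_nonneg _ _) (hK y y')) (S := cvSk d L mv kk hL k) (χ := fun p : ScX' d L mv kk r hL × ι => scChi' d L mv kk r hL k p.1)
    (fun p => abs_chiCube_le_one _ _)
    (fun p hp => Finset.mem_coe.mpr (by
      rw [scChi'_eq_scChi_kingPr] at hp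
      exact blockOf_mem_cubeBlocks_of_inner_ne_zero hM hm₁ hfitI hS0 (x := (kingPr L kk r (cvM d L mv kk hL) p.1, (0 : Fin (d + 1)))) hp))
    (hasMaj_tgt_congr (liftBlk_scBlk_comp_liftMap_kingPr (d := d) (hL := hL) ι).symm h1)
  exact h2.mono fun y y' => le_of_eq (by ring)

/-- ★★ **53's `hDcutF` ON SITES**: `𝔇_{P̂,P̂}(M_{χ′_k}∘∇′_μ∘(G′′(1)∘M_{ψ′_k}), M_{χ_k}∘∇_μ∘(G′(1)∘M_{ψ_k})) ≤ 1_□1_□·K` from the flat two-grid row of the GRADIENTS `𝔇_{P̂,P̂_V}(∂′G′′(1), ∂G′(1)) ≤ K`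
(Ξ-4 r10 shape; site input, bond output), read on sites by `∇_μ∘mulVecLin G = pull_μ∘mulVecLin(∂G)` on both grids. [cite: Balaban1985BackgroundPropagators, Thm 3.14 pp.426–427 (template); King1986, p.664] -/
theorem hasMaj_idef_cutF_scCube {a a' : ℝ} {K : Tor (cvM d L mv kk hL) → Tor (cvM d L mv kk hL) → ℝ} (hK : ∀ y y', 0 ≤ K y y') (μ : Fin (d + 1))
    (hDGF : HasMaj (ScNorm d L mv kk hL ι)
      (BlockNorm.ofBlocks (unitTorusGeo L kk (cvM d L mv kk hL)) (liftBlk (fun b : ScX' d L mv kk r hL × Fin (d + 1) => blockOf (L ^ r * L ^ kk) (cvM d L mv kk hL) b.1) ι))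
      (idef (pull (liftMap (kingPr L kk r (cvM d L mv kk hL)) ι)) (pull (liftMap (kingPrV L kk r (cvM d L mv kk hL)) ι))
        (Matrix.mulVecLin (cgrad (cvM d L mv kk hL) (L ^ r * L ^ kk) (fun (_ : Fin (d + 1)) (_ : ScX' d L mv kk r hL) => (1 : Matrix ι ι ℝ)) *
          cGreen (cvM d L mv kk hL) (L ^ r * L ^ kk) (fun (_ : Fin (d + 1)) (_ : ScX' d L mv kk r hL) => (1 : Matrix ι ι ℝ)) a'))
        (Matrix.mulVecLin (cgrad (cvM d L mv kk hL) (L ^ kk) (fun (_ : Fin (d + 1)) (_ : ScX d L mv kk hL) => (1 : Matrix ι ι ℝ)) *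
          cGreen (cvM d L mv kk hL) (L ^ kk) (fun (_ : Fin (d + 1)) (_ : ScX d L mv kk hL) => (1 : Matrix ι ι ℝ)) a))) K)
    (k : Fin (d + 1) → ZMod (2 * L)) :
    HasMaj (ScNorm d L mv kk hL ι) (BlockNorm.ofBlocks (unitTorusGeo L kk (cvM d L mv kk hL)) (liftBlk (scBlk d L mv kk hL) ι ∘ liftMap (kingPr L kk r (cvM d L mv kk hL)) ι))
      (idef (pull (liftMap (kingPr L kk r (cvM d L mv kk hL)) ι)) (pull (liftMap (kingPr L kk r (cvM d L mv kk hL)) ι))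
        (mulOp (fun p : ScX' d L mv kk r hL × ι => scChi' d L mv kk r hL k p.1) ∘ₗ
          (fgrad ((((L ^ r * L ^ kk : ℕ) : ℝ))⁻¹)⁻¹ (liftEquiv (scShift' d L mv kk r hL μ) ι) ∘ₗ scCube' d L mv kk r hL a' ι k))
        (mulOp (fun p : ScX d L mv kk hL × ι => scChi d L mv kk hL k p.1) ∘ₗ
          (fgrad ((((L ^ kk : ℕ) : ℝ))⁻¹)⁻¹ (liftEquiv (scShift d L mv kk hL μ) ι) ∘ₗ scCube d L mv kk hL a ι k)))
      (fun y y' => ind (cvSk d L mv kk hL k) y * ind (cvSk d L mv kk hL k) y' * K y y') := by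
  rw [inv_inv, inv_inv, scCube, scCube', ← LinearMap.comp_assoc (mulOp fun p : ScX d L mv kk hL × ι => scPsi d L mv kk hL k p.1),
    ← LinearMap.comp_assoc (mulOp fun p : ScX' d L mv kk r hL × ι => scPsi' d L mv kk r hL k p.1), fgrad_comp_mulVecLin_eq_pull, fgrad_comp_mulVecLin_eq_pull',
    idef_cut_comp _ _ (pull_comp_mulOp_scChi (d := d) (hL := hL) ι k), idef_comp_cut _ (mulOp_scPsi'_comp_pull (d := d) (hL := hL) ι k),
    idef_pullSlice _ (pull_kingPr_comp_pullSlice (d := d) (hL := hL) ι μ)]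
  have h1 := hasMaj_comp_mulOp_cut
    (b₂ := BlockNorm.ofBlocks (unitTorusGeo L kk (cvM d L mv kk hL)) (liftBlk (fun b : ScX' d L mv kk r hL × Fin (d + 1) => blockOf (L ^ r * L ^ kk) (cvM d L mv kk hL) b.1) ι))
    (liftBlk (scBlk d L mv kk hL) ι) hK (S := cvSk d L mv kk hL k) (χ := fun p : ScX d L mv kk hL × ι => scPsi d L mv kk hL k p.1) (fun p => abs_chiCube_le_one _ _)
    (fun p hp => Finset.mem_coe.mpr (by by_contra h; exact hp (chiCube_of_not_mem h))) hDGF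
  have h1' := hasMaj_pullCarrier_comp (g := unitTorusGeo L kk (cvM d L mv kk hL))
    (liftBlk (fun b : ScX' d L mv kk r hL × Fin (d + 1) => blockOf (L ^ r * L ^ kk) (cvM d L mv kk hL) b.1) ι) (liftBlk (blockOf (L ^ r * L ^ kk) (cvM d L mv kk hL)) ι)
    (fun p : ScX' d L mv kk r hL × ι => ((p.1, μ), p.2)) (fun _ => rfl) (fun y y' => mul_nonneg (ind_nonneg _ _) (hK y y')) h1
  have h2 := hasMaj_mulOp_cut_comp (b₁ := ScNorm d L mv kk hL ι) (liftBlk (scBlk d L mv kk hL) ι ∘ liftMap (kingPr L kk r (cvM d L mv kk hL)) ι)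
    (fun y y' => mul_nonneg (ind_nonneg _ _) (hK y y')) (S := cvSk d L mv kk hL k) (χ := fun p : ScX' d L mv kk r hL × ι => scChi' d L mv kk r hL k p.1)
    (fun p => abs_chiCube_le_one _ _)
    (fun p hp => Finset.mem_coe.mpr (by
      rw [scChi'_eq_scChi_kingPr] at hp
      exact blockOf_mem_cubeBlocks_of_inner_ne_zero hM hm₁ hfitI hS0 (x := (kingPr L kk r (cvM d L mv kk hL) p.1, (0 : Fin (d + 1)))) hp))
    (hasMaj_tgt_congr (liftBlk_scBlk_comp_liftMap_kingPr (d := d) (hL := hL) ι).symm (by rw [← LinearMap.comp_assoc] at h1'; exact h1'))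
  rw [LinearMap.comp_assoc] at h2 ⊢
  exact (h2.mono fun y y' => le_of_eq (by ring))

/-- ★★ **53's `hDcutB` ON SITES**: the same for the BACKWARD quotients, from the flat two-grid row of `S̄ₕ∂G′(1)` (Ξ-4 r12 shape). [cite: Balaban1985BackgroundPropagators, Thm 3.14 pp.426–427 (template); Balaban1984PropagatorsI, (1.3) p.18; King1986, p.664] -/
theorem hasMaj_idef_cutB_scCube {a a' : ℝ} {K : Tor (cvM d L mv kk hL) → Tor (cvM d L mv kk hL) → ℝ} (hK : ∀ y y', 0 ≤ K y y') (μ : Fin (d + 1))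
    (hDGB : HasMaj (ScNorm d L mv kk hL ι)
      (BlockNorm.ofBlocks (unitTorusGeo L kk (cvM d L mv kk hL)) (liftBlk (fun b : ScX' d L mv kk r hL × Fin (d + 1) => blockOf (L ^ r * L ^ kk) (cvM d L mv kk hL) b.1) ι))
      (idef (pull (liftMap (kingPr L kk r (cvM d L mv kk hL)) ι)) (pull (liftMap (kingPrV L kk r (cvM d L mv kk hL)) ι))
        (Matrix.mulVecLin (bBack (cvM d L mv kk hL) (L ^ r * L ^ kk) (ι := ι) * (cgrad (cvM d L mv kk hL) (L ^ r * L ^ kk) (fun (_ : Fin (d + 1)) (_ : ScX' d L mv kk r hL) => (1 : Matrix ι ι ℝ)) *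
          cGreen (cvM d L mv kk hL) (L ^ r * L ^ kk) (fun (_ : Fin (d + 1)) (_ : ScX' d L mv kk r hL) => (1 : Matrix ι ι ℝ)) a')))
        (Matrix.mulVecLin (bBack (cvM d L mv kk hL) (L ^ kk) (ι := ι) * (cgrad (cvM d L mv kk hL) (L ^ kk) (fun (_ : Fin (d + 1)) (_ : ScX d L mv kk hL) => (1 : Matrix ι ι ℝ)) *
          cGreen (cvM d L mv kk hL) (L ^ kk) (fun (_ : Fin (d + 1)) (_ : ScX d L mv kk hL) => (1 : Matrix ι ι ℝ)) a)))) K)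
    (k : Fin (d + 1) → ZMod (2 * L)) :
    HasMaj (ScNorm d L mv kk hL ι) (BlockNorm.ofBlocks (unitTorusGeo L kk (cvM d L mv kk hL)) (liftBlk (scBlk d L mv kk hL) ι ∘ liftMap (kingPr L kk r (cvM d L mv kk hL)) ι))
      (idef (pull (liftMap (kingPr L kk r (cvM d L mv kk hL)) ι)) (pull (liftMap (kingPr L kk r (cvM d L mv kk hL)) ι))
        (mulOp (fun p : ScX' d L mv kk r hL × ι => scChi' d L mv kk r hL k p.1) ∘ₗ
          (bgrad ((((L ^ r * L ^ kk : ℕ) : ℝ))⁻¹)⁻¹ (liftEquiv (scShift' d L mv kk r hL μ) ι) ∘ₗ scCube' d L mv kk r hL a' ι k))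
        (mulOp (fun p : ScX d L mv kk hL × ι => scChi d L mv kk hL k p.1) ∘ₗ
          (bgrad ((((L ^ kk : ℕ) : ℝ))⁻¹)⁻¹ (liftEquiv (scShift d L mv kk hL μ) ι) ∘ₗ scCube d L mv kk hL a ι k)))
      (fun y y' => ind (cvSk d L mv kk hL k) y * ind (cvSk d L mv kk hL k) y' * K y y') := by
  rw [inv_inv, inv_inv, scCube, scCube', ← LinearMap.comp_assoc (mulOp fun p : ScX d L mv kk hL × ι => scPsi d L mv kk hL k p.1),
    ← LinearMap.comp_assoc (mulOp fun p : ScX' d L mv kk r hL × ι => scPsi' d L mv kk r hL k p.1), bgrad_comp_mulVecLin_eq_pull, bgrad_comp_mulVecLin_eq_pull',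
    idef_cut_comp _ _ (pull_comp_mulOp_scChi (d := d) (hL := hL) ι k), idef_comp_cut _ (mulOp_scPsi'_comp_pull (d := d) (hL := hL) ι k),
    idef_pullSlice _ (pull_kingPr_comp_pullSlice (d := d) (hL := hL) ι μ)]
  have h1 := hasMaj_comp_mulOp_cut
    (b₂ := BlockNorm.ofBlocks (unitTorusGeo L kk (cvM d L mv kk hL)) (liftBlk (fun b : ScX' d L mv kk r hL × Fin (d + 1) => blockOf (L ^ r * L ^ kk) (cvM d L mv kk hL) b.1) ι))
    (liftBlk (scBlk d L mv kk hL) ι) hK (S := cvSk d L mv kk hL k) (χ := fun p : ScX d L mv kk hL × ι => scPsi d L mv kk hL k p.1) (fun p => abs_chiCube_le_one _ _)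
    (fun p hp => Finset.mem_coe.mpr (by by_contra h; exact hp (chiCube_of_not_mem h))) hDGB
  have h1' := hasMaj_pullCarrier_comp (g := unitTorusGeo L kk (cvM d L mv kk hL))
    (liftBlk (fun b : ScX' d L mv kk r hL × Fin (d + 1) => blockOf (L ^ r * L ^ kk) (cvM d L mv kk hL) b.1) ι) (liftBlk (blockOf (L ^ r * L ^ kk) (cvM d L mv kk hL)) ι)
    (fun p : ScX' d L mv kk r hL × ι => ((p.1, μ), p.2)) (fun _ => rfl) (fun y y' => mul_nonneg (ind_nonneg _ _) (hK y y')) h1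
  have h2 := hasMaj_mulOp_cut_comp (b₁ := ScNorm d L mv kk hL ι) (liftBlk (scBlk d L mv kk hL) ι ∘ liftMap (kingPr L kk r (cvM d L mv kk hL)) ι)
    (fun y y' => mul_nonneg (ind_nonneg _ _) (hK y y')) (S := cvSk d L mv kk hL k) (χ := fun p : ScX' d L mv kk r hL × ι => scChi' d L mv kk r hL k p.1)
    (fun p => abs_chiCube_le_one _ _)
    (fun p hp => Finset.mem_coe.mpr (by
      rw [scChi'_eq_scChi_kingPr] at hp
      exact blockOf_mem_cubeBlocks_of_inner_ne_zero hM hm₁ hfitI hS0 (x := (kingPr L kk r (cvM d L mv kk hL) p.1, (0 : Fin (d + 1)))) hp))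
    (hasMaj_tgt_congr (liftBlk_scBlk_comp_liftMap_kingPr (d := d) (hL := hL) ι).symm (by rw [← LinearMap.comp_assoc] at h1'; exact h1'))
  rw [LinearMap.comp_assoc] at h2 ⊢
  exact (h2.mono fun y y' => le_of_eq (by ring))

end CutRows

end Summit.QuantumFields.YangMills.BalabanUVNodes.N15.Gluing

end
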